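import Mathlib

/-!
# Toolkit D — the `act` calculus (a coefficient polynomial acting on `ℂ[X]` through `divX`)

Support file for crux item `stmt-MatrixMultiplication-10752`
(`Summit.MatrixMultiplication.MatrixMultiplication.Theses.HiddenToeplitzCorners.HiddenCornerLemmaR`),
line `frobenius-dual-short-syzygies`, stub group TOOLKIT-D of the strip theorem /
`stub_gconstDualLaw`
(paper proof `math/STRIP_THEOREM.md` §1: the algebra behind the step lemma (PS), which transports
relations of a frame `E` to relations of the shifted frame `δ^[v] ∘ E` through multiplication by a
polynomial `g = X^v g₀` with `g₀(0) ≠ 0`).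

Setting.  `δ := Polynomial.divX` is the down-shift on `ℂ[X]`; a coefficient polynomial `α` acts on
`f ∈ ℂ[X]` by `act α f := Σ_i (coeff α i) • δ^[i] f`, written through `Polynomial.lsum` as
`(Polynomial.lsum (fun i => LinearMap.smulRight LinearMap.id (δ^[i] f))) α` (all statements below
are in this expanded, notation-free form).  This is the `ℂ[X]`-module structure on `ℂ[X]` in which
`X` acts as `δ`, i.e. `act α f = α(δ) f`.

Results (folklore polynomial algebra):
* `hclR_act_mul` (D1): `act (α * β) f = act α (act β f)`;
* (D2) `act (X ^ v) f = δ^[v] f` is ALREADY in the tree as `hclR_act_X_pow` of the toolkit-B module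
  `Summits.MatrixMultiplication.MatrixMultiplication.Theorems.HiddenToeplitzCornersHiddenCornerLemmaRCapacityKrylov`
  (same namespace, same name, same statement), so it is not re-declared here (here it is the case
  `a = 1` of `hclR_capD_act_monomial` via `X ^ v = monomial v 1`);
* `hclR_act_divX_comm` (D3): `act α (δ f) = δ (act α f)`;
* `hclR_divX_iterate_eq_zero_iff` (D4): `δ^[v] p = 0 ↔ p ∈ degreeLT v`;
* `hclR_act_injective_of_coeff_zero_ne` (D5): if `coeff g₀ 0 ≠ 0` then `act g₀ f = 0 → f = 0`
  (compare the coefficients of `X^(natDegree f)`: only the `i = 0` term contributes);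
* `hclR_eq_X_pow_mul_divX_iterate` (D6): for `g ≠ 0` and `v := natTrailingDegree g`,
  `g = X ^ v * δ^[v] g` and `coeff (δ^[v] g) 0 = coeff g v ≠ 0`;
* `hclR_act_add_right`, `hclR_act_smul_right` (D7): `act α f` is `ℂ`-linear in `f`;
* `hclR_act_mem_degreeLT` (D8): `f ∈ degreeLT n → act α f ∈ degreeLT n`.
D1, D3, D7, D8 are reduced by linearity in `α` (`Polynomial.induction_on'`) to monomials
`α = a X^n`, where `act (a X^n) f = a • δ^[n] f` (`hclR_capD_act_monomial`).
Helpers (`hclR_capD_*`): coefficients / additivity / homogeneity / degree bound of `δ^[k]`, the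
action of a monomial, and `act (X ^ n * β) f = δ^[n] (act β f)`.
-/

-- the problem namespace `…MatrixMultiplication.MatrixMultiplication…` repeats a component by design
set_option linter.dupNamespace false

namespace Summit.MatrixMultiplication.MatrixMultiplication.Theorems

open Polynomial

/-! ## Helpers: the iterated down-shift `δ^[k]` -/

/-- Coefficients of the iterated down-shift: `coeff (δ^[k] p) i = coeff p (i + k)`. -/
theorem hclR_capD_coeff_divX_iterate (p : ℂ[X]) (k i : ℕ) :
    (Polynomial.divX^[k] p).coeff i = p.coeff (i + k) := by
  induction k generalizing i with
  | zero => rfl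
  | succ k ih =>
    rw [Function.iterate_succ_apply', Polynomial.coeff_divX, ih, Nat.add_right_comm, Nat.add_assoc]

/-- `δ^[k]` is additive. -/
theorem hclR_capD_divX_iterate_add (p q : ℂ[X]) (k : ℕ) :
    Polynomial.divX^[k] (p + q) = Polynomial.divX^[k] p + Polynomial.divX^[k] q := by
  induction k with
  | zero => rfl
  | succ k ih =>
    rw [Function.iterate_succ_apply', Function.iterate_succ_apply', Function.iterate_succ_apply',
      ih, Polynomial.divX_add]

/-- `δ^[k]` is `ℂ`-homogeneous. -/
theorem hclR_capD_divX_iterate_smul (a : ℂ) (p : ℂ[X]) (k : ℕ) :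
    Polynomial.divX^[k] (a • p) = a • Polynomial.divX^[k] p := by
  induction k with
  | zero => rfl
  | succ k ih =>
    rw [Function.iterate_succ_apply', Function.iterate_succ_apply', ih, Polynomial.smul_eq_C_mul,
      Polynomial.smul_eq_C_mul, Polynomial.divX_C_mul]

/-- `δ^[k]` does not raise degrees: `p ∈ degreeLT n → δ^[k] p ∈ degreeLT n`. -/
theorem hclR_capD_divX_iterate_mem_degreeLT {n : ℕ} {p : ℂ[X]}
    (hp : p ∈ Polynomial.degreeLT ℂ n) (k : ℕ) :
    Polynomial.divX^[k] p ∈ Polynomial.degreeLT ℂ n := by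
  rw [Polynomial.mem_degreeLT, Polynomial.degree_lt_iff_coeff_zero] at hp ⊢
  intro m hm
  rw [hclR_capD_coeff_divX_iterate]
  exact hp (m + k) (le_trans hm (Nat.le_add_right m k))

/-! ## Helpers: the action of a monomial and of `X ^ n * β` -/

/-- The action of a monomial coefficient polynomial: `act (a X^n) f = a • δ^[n] f`. -/
theorem hclR_capD_act_monomial (f : ℂ[X]) (n : ℕ) (a : ℂ) :
    ((Polynomial.lsum (fun (i : ℕ) => LinearMap.smulRight (LinearMap.id : ℂ →ₗ[ℂ] ℂ)
      (Polynomial.divX^[i] (f : Polynomial ℂ))) : Polynomial ℂ →ₗ[ℂ] Polynomial ℂ))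
        (Polynomial.monomial n a) = a • Polynomial.divX^[n] f := by
  rw [Polynomial.lsum_apply, Polynomial.sum_monomial_index]
  · rfl
  · simp

/-- `act (X ^ n * β) f = δ^[n] (act β f)`: multiplying the coefficient polynomial by `X ^ n`
shifts its coefficients up by `n`. -/
theorem hclR_capD_act_X_pow_mul (f β : ℂ[X]) (n : ℕ) :
    ((Polynomial.lsum (fun (i : ℕ) => LinearMap.smulRight (LinearMap.id : ℂ →ₗ[ℂ] ℂ)
      (Polynomial.divX^[i] (f : Polynomial ℂ))) : Polynomial ℂ →ₗ[ℂ] Polynomial ℂ)) (X ^ n * β) =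
    Polynomial.divX^[n]
      (((Polynomial.lsum (fun (i : ℕ) => LinearMap.smulRight (LinearMap.id : ℂ →ₗ[ℂ] ℂ)
        (Polynomial.divX^[i] (f : Polynomial ℂ))) : Polynomial ℂ →ₗ[ℂ] Polynomial ℂ)) β) := by
  induction β using Polynomial.induction_on' with
  | add p q hp hq => rw [mul_add, map_add, map_add, hp, hq, hclR_capD_divX_iterate_add]
  | monomial m b =>
    rw [Polynomial.X_pow_mul_monomial, hclR_capD_act_monomial, hclR_capD_act_monomial,
      hclR_capD_divX_iterate_smul, Nat.add_comm, Function.iterate_add_apply]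

/-! ## The registered toolkit statements

(D2) `hclR_act_X_pow` lives in the toolkit-B module `…HiddenToeplitzCornersHiddenCornerLemmaRCapacityKrylov`. -/

/-- **(D1)** `act (α * β) f = act α (act β f)`: the action is multiplicative in the coefficient
polynomial (it is the `ℂ[X]`-module structure on `ℂ[X]` in which `X` acts as `δ`).  By linearity
in `α` it suffices to treat `α = a X^n`, where both sides are `a • δ^[n] (act β f)`. -/
theorem hclR_act_mul :
    ∀ (f α β : (Polynomial ℂ)), ((Polynomial.lsum (fun (i : ℕ) => LinearMap.smulRight
    (LinearMap.id : ℂ →ₗ[ℂ] ℂ) (Polynomial.divX^[i] (f : Polynomial ℂ))) :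
    Polynomial ℂ →ₗ[ℂ] Polynomial ℂ)) (α * β) = ((Polynomial.lsum (fun (i : ℕ) =>
    LinearMap.smulRight (LinearMap.id : ℂ →ₗ[ℂ] ℂ) (Polynomial.divX^[i] (((Polynomial.lsum
    (fun (i : ℕ) => LinearMap.smulRight (LinearMap.id : ℂ →ₗ[ℂ] ℂ) (Polynomial.divX^[i]
    (f : Polynomial ℂ))) : Polynomial ℂ →ₗ[ℂ] Polynomial ℂ)) β : Polynomial ℂ))) :
    Polynomial ℂ →ₗ[ℂ] Polynomial ℂ)) α := by
  intro f α β
  induction α using Polynomial.induction_on' with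
  | add p q hp hq => rw [add_mul, map_add, map_add, hp, hq]
  | monomial n a =>
    rw [hclR_capD_act_monomial, ← Polynomial.C_mul_X_pow_eq_monomial, mul_assoc,
      ← Polynomial.smul_eq_C_mul, map_smul, hclR_capD_act_X_pow_mul]

/-- **(D3)** `act α (δ f) = δ (act α f)`: the action commutes with the down-shift in the vector
argument (each `δ^[i]` commutes with `δ`, and `δ` is `ℂ`-linear). -/
theorem hclR_act_divX_comm :
    ∀ (f α : (Polynomial ℂ)), ((Polynomial.lsum (fun (i : ℕ) => LinearMap.smulRight
    (LinearMap.id : ℂ →ₗ[ℂ] ℂ) (Polynomial.divX^[i] (Polynomial.divX f : Polynomial ℂ))) :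
    Polynomial ℂ →ₗ[ℂ] Polynomial ℂ)) α = Polynomial.divX (((Polynomial.lsum (fun (i : ℕ) =>
    LinearMap.smulRight (LinearMap.id : ℂ →ₗ[ℂ] ℂ) (Polynomial.divX^[i] (f : Polynomial ℂ))) :
    Polynomial ℂ →ₗ[ℂ] Polynomial ℂ)) α) := by
  intro f α
  induction α using Polynomial.induction_on' with
  | add p q hp hq => rw [map_add, map_add, hp, hq, Polynomial.divX_add]
  | monomial n a =>
    rw [hclR_capD_act_monomial, hclR_capD_act_monomial, ← Function.iterate_succ_apply,
      Function.iterate_succ_apply', Polynomial.smul_eq_C_mul, Polynomial.smul_eq_C_mul,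
      Polynomial.divX_C_mul]

/-- **(D4)** The kernel of the iterated down-shift: `δ^[v] p = 0 ↔ p ∈ degreeLT v`, since
`coeff (δ^[v] p) n = coeff p (n + v)`. -/
theorem hclR_divX_iterate_eq_zero_iff :
    ∀ (p : (Polynomial ℂ)) (v : ℕ), Polynomial.divX^[v] p = 0 ↔ p ∈ Polynomial.degreeLT ℂ v := by
  intro p v
  rw [Polynomial.mem_degreeLT, Polynomial.degree_lt_iff_coeff_zero, Polynomial.ext_iff]
  simp only [hclR_capD_coeff_divX_iterate, Polynomial.coeff_zero]
  constructor
  · intro h m hm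
    obtain ⟨k, rfl⟩ := Nat.exists_eq_add_of_le hm
    rw [Nat.add_comm]
    exact h k
  · intro h n
    exact h (n + v) (Nat.le_add_left v n)

-- The registered signature (kept verbatim) names the hypothesis binders `h`, `h0`, which the
-- statement itself does not reference; silence the unused-variable linter on this declaration.
set_option linter.unusedVariables false in
/-- **(D5)** A coefficient polynomial with nonzero constant term acts injectively: if
`coeff g₀ 0 ≠ 0` and `act g₀ f = 0` then `f = 0`.  Indeed for `f ≠ 0` the coefficient of
`X^(natDegree f)` in `act g₀ f = Σ_i coeff g₀ i • δ^[i] f` is `coeff g₀ 0 * leadingCoeff f ≠ 0`,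
because `coeff (δ^[i] f) (natDegree f) = coeff f (natDegree f + i) = 0` for `i ≥ 1`. -/
theorem hclR_act_injective_of_coeff_zero_ne :
    ∀ (g₀ f : (Polynomial ℂ)) (h : g₀.coeff 0 ≠ 0) (h0 : ((Polynomial.lsum (fun (i : ℕ) =>
    LinearMap.smulRight (LinearMap.id : ℂ →ₗ[ℂ] ℂ) (Polynomial.divX^[i] (f : Polynomial ℂ))) :
    Polynomial ℂ →ₗ[ℂ] Polynomial ℂ)) g₀ = 0), f = 0 := by
  intro g₀ f h h0
  by_contra hf
  have key : (((Polynomial.lsum (fun (i : ℕ) => LinearMap.smulRight (LinearMap.id : ℂ →ₗ[ℂ] ℂ)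
      (Polynomial.divX^[i] (f : Polynomial ℂ))) : Polynomial ℂ →ₗ[ℂ] Polynomial ℂ)) g₀).coeff
      f.natDegree = g₀.coeff 0 * f.leadingCoeff := by
    rw [Polynomial.lsum_apply, Polynomial.sum_def, Polynomial.finsetSum_coeff,
      Finset.sum_eq_single (0 : ℕ)]
    · simp only [LinearMap.smulRight_apply, LinearMap.id_apply, Polynomial.coeff_smul, smul_eq_mul,
        Function.iterate_zero_apply, Polynomial.coeff_natDegree]
    · intro i _ hi
      simp only [LinearMap.smulRight_apply, LinearMap.id_apply, Polynomial.coeff_smul, smul_eq_mul,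
        hclR_capD_coeff_divX_iterate]
      rw [Polynomial.coeff_eq_zero_of_natDegree_lt (show f.natDegree < f.natDegree + i by omega),
        mul_zero]
    · intro h0'
      exact absurd (Polynomial.mem_support_iff.mpr h) h0'
  rw [h0, Polynomial.coeff_zero] at key
  exact mul_ne_zero h (Polynomial.leadingCoeff_ne_zero.mpr hf) key.symm

-- As for (D5): the registered signature names the binder `hg`, not referenced by the statement.
set_option linter.unusedVariables false in
/-- **(D6)** Valuation factorisation: for `g ≠ 0` and `v := natTrailingDegree g` one has
`g = X ^ v * g₀` with `g₀ := δ^[v] g` and `coeff g₀ 0 = coeff g v ≠ 0` (the coefficients of `g`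
below `v` vanish, and `coeff (X ^ v * g₀) m = coeff g₀ (m - v) = coeff g m` for `m ≥ v`). -/
theorem hclR_eq_X_pow_mul_divX_iterate :
    ∀ (g : (Polynomial ℂ)) (hg : g ≠ 0), g = Polynomial.X ^ g.natTrailingDegree *
    (Polynomial.divX^[g.natTrailingDegree] g) ∧
    (Polynomial.divX^[g.natTrailingDegree] g).coeff 0 ≠ 0 := by
  intro g hg
  refine ⟨Polynomial.ext fun m => ?_, ?_⟩
  · rw [Polynomial.coeff_X_pow_mul']
    split_ifs with hm
    · rw [hclR_capD_coeff_divX_iterate, Nat.sub_add_cancel hm]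
    · exact Polynomial.coeff_eq_zero_of_lt_natTrailingDegree (not_le.mp hm)
  · rw [hclR_capD_coeff_divX_iterate, Nat.zero_add]
    exact Polynomial.coeff_natTrailingDegree_ne_zero.mpr hg

/-- **(D7a)** Additivity of `act α f` in the vector argument `f`. -/
theorem hclR_act_add_right :
    ∀ (f f' α : (Polynomial ℂ)), ((Polynomial.lsum (fun (i : ℕ) => LinearMap.smulRight
    (LinearMap.id : ℂ →ₗ[ℂ] ℂ) (Polynomial.divX^[i] (f + f' : Polynomial ℂ))) :
    Polynomial ℂ →ₗ[ℂ] Polynomial ℂ)) α = ((Polynomial.lsum (fun (i : ℕ) => LinearMap.smulRight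
    (LinearMap.id : ℂ →ₗ[ℂ] ℂ) (Polynomial.divX^[i] (f : Polynomial ℂ))) :
    Polynomial ℂ →ₗ[ℂ] Polynomial ℂ)) α + ((Polynomial.lsum (fun (i : ℕ) => LinearMap.smulRight
    (LinearMap.id : ℂ →ₗ[ℂ] ℂ) (Polynomial.divX^[i] (f' : Polynomial ℂ))) :
    Polynomial ℂ →ₗ[ℂ] Polynomial ℂ)) α := by
  intro f f' α
  induction α using Polynomial.induction_on' with
  | add p q hp hq => rw [map_add, map_add, map_add, hp, hq, add_add_add_comm]
  | monomial n a =>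
    rw [hclR_capD_act_monomial, hclR_capD_act_monomial, hclR_capD_act_monomial,
      hclR_capD_divX_iterate_add, smul_add]

/-- **(D7b)** Homogeneity of `act α f` in the vector argument `f`. -/
theorem hclR_act_smul_right :
    ∀ (a : ℂ) (f α : (Polynomial ℂ)), ((Polynomial.lsum (fun (i : ℕ) => LinearMap.smulRight
    (LinearMap.id : ℂ →ₗ[ℂ] ℂ) (Polynomial.divX^[i] (a • f : Polynomial ℂ))) :
    Polynomial ℂ →ₗ[ℂ] Polynomial ℂ)) α = a • ((Polynomial.lsum (fun (i : ℕ) => LinearMap.smulRight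
    (LinearMap.id : ℂ →ₗ[ℂ] ℂ) (Polynomial.divX^[i] (f : Polynomial ℂ))) :
    Polynomial ℂ →ₗ[ℂ] Polynomial ℂ)) α := by
  intro a f α
  induction α using Polynomial.induction_on' with
  | add p q hp hq => rw [map_add, map_add, hp, hq, smul_add]
  | monomial n b =>
    rw [hclR_capD_act_monomial, hclR_capD_act_monomial, hclR_capD_divX_iterate_smul, smul_comm]

-- As for (D5): the registered signature names the binder `hf`, not referenced by the statement.
set_option linter.unusedVariables false in
/-- **(D8)** The action never raises degrees: `f ∈ degreeLT n → act α f ∈ degreeLT n`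
(each `δ^[i] f` lies in `degreeLT n`, which is a submodule). -/
theorem hclR_act_mem_degreeLT :
    ∀ (f α : (Polynomial ℂ)) (n : ℕ) (hf : f ∈ Polynomial.degreeLT ℂ n), ((Polynomial.lsum
    (fun (i : ℕ) => LinearMap.smulRight (LinearMap.id : ℂ →ₗ[ℂ] ℂ) (Polynomial.divX^[i]
    (f : Polynomial ℂ))) : Polynomial ℂ →ₗ[ℂ] Polynomial ℂ)) α ∈ Polynomial.degreeLT ℂ n := by
  intro f α n hf
  induction α using Polynomial.induction_on' with
  | add p q hp hq =>
    rw [map_add]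
    exact Submodule.add_mem _ hp hq
  | monomial m a =>
    rw [hclR_capD_act_monomial]
    exact Submodule.smul_mem _ a (hclR_capD_divX_iterate_mem_degreeLT hf m)

end Summit.MatrixMultiplication.MatrixMultiplication.Theorems
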